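import Mathlib

/-!
# Route `OddParityLadder`, crux `OddSignQuad` (stmt-Parity-30152): the BC5/T3 WITNESS — proved instances of the
# Liouville-sign floor on single quadratics, by Pell certificates

`OddSignQuad` (node B1.1.1.2 «LiouvilleSignFloor», lens-1 g5; route rev 3, commit eeafa223f5f9) says: for every
irreducible quadratic `q` with `IsBatemanHornSystem ![q]`, the set `{n : 1 < q(n) ∧ Ω(q(n)) odd}` is infinite
(λ(q(n)) = −1 infinitely often).  This file proves that CONCLUSION outright for three quadratics —
`X² + 1` (the cell E, where Bateman–Horn's own instance is Landau's problem), `X² + 2`, and `X² + X + 1` (b ≠ 0: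
outside the printed x²+d theorem of Srinivasan 2021/22, arXiv:2104.15004 Thm 3) — each by a PELL CERTIFICATE:
a strictly increasing orbit `n_j` with `q(n_j) = l·m_j²`, `Ω(l)` odd, whence `Ω(q(n_j)) = Ω(l) + 2Ω(m_j)` is odd
(`ArithmeticFunction.cardFactors_mul/_pow`).  Orbits: `n²+1 = 2m²`, (1,1) ↦ (3n+4m, 2n+3m) (n = 1, 7, 41, 239, …;
Borwein–Choi–Ganguli 2013); `n²+2 = 3m²`, (1,1) ↦ (2n+3m, n+2m); `n²+n+1 = 3m²`, (1,1) ↦ (7n+12m+3, 4n+7m+2)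
(n = 1, 22, 313, …).  These are INSTANCES of the crux in a regime where the summit's instance is open — the
tribunal's T3 witness of weakness — and NOT rungs of the ∀-quadratic claim (critic P1, HOME/STATUS.md l.250):
credit for `OddSignQuad` is in CELL currency (x²+d proved in print; all ax²+bx+c open).  Mathlib only, NO definitions (the three orbits are obtained from
`exists_orbit` as anonymous sequences with their start/step equations — hand-seat edit of the planner's file, which
used recursive `def`s); the certificate schema `oddSign_single_of_family` is the node's INSTRUMENT (finite data (l; n₀, m₀; recursion) per
quadratic, kernel-decided by `nlinarith`/`omega`, no `native_decide`).  Candidate file by the planner (lens-1 g5);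
to be landed by a hand as `Summits/Parity/BatemanHorn/Theorems/OddParityLadderOddSignQuadWitnesses.lean
--supports stmt-Parity-30152`.
-/

namespace Summit.Parity.BatemanHorn.Theorems.OddSignQuadWitnesses

open Polynomial

/-- CERTIFICATE SCHEMA: a strictly increasing family of arguments on which `q` takes values `l·m²` with `Ω(l)`
odd and `m ≥ 1` makes `{n : 1 < q(n) ∧ Ω(q(n)) odd}` infinite. [folklore] -/
theorem oddSign_single_of_family (q : ℤ[X]) (l : ℕ) (hl : Odd (ArithmeticFunction.cardFactors l))
    (a m : ℕ → ℕ) (ha : StrictMono a) (hm : ∀ j, 1 ≤ m j)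
    (hq : ∀ j, q.eval ((a j : ℕ) : ℤ) = ((l * m j ^ 2 : ℕ) : ℤ)) :
    Set.Infinite {n : ℕ | 1 < q.eval (n : ℤ) ∧
      Odd (ArithmeticFunction.cardFactors ((q.eval (n : ℤ)).toNat))} := by
  have hl0 : l ≠ 0 := by
    rintro rfl
    simp at hl
  refine Set.infinite_of_injective_forall_mem ha.injective fun j => ?_
  have hm0 : m j ≠ 0 := by have := hm j; omega
  have hl1 : 1 < l := ArithmeticFunction.cardFactors_pos_iff_one_lt.mp hl.pos
  have hval : 1 < l * m j ^ 2 := by nlinarith [hm j]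
  refine ⟨?_, ?_⟩
  · rw [hq j]
    exact_mod_cast hval
  · rw [hq j, Int.toNat_natCast, ArithmeticFunction.cardFactors_mul hl0 (pow_ne_zero 2 hm0),
      ArithmeticFunction.cardFactors_pow]
    exact hl.add_even (even_two_mul _)

/-- ORBIT EXISTENCE (replaces recursive definitions): a sequence with prescribed start and step. [folklore] -/
theorem exists_orbit (x₀ : ℕ × ℕ) (step : ℕ × ℕ → ℕ × ℕ) :
    ∃ f : ℕ → ℕ × ℕ, f 0 = x₀ ∧ ∀ j, f (j + 1) = step (f j) :=
  ⟨fun j => step^[j] x₀, rfl, fun j => Function.iterate_succ_apply' step j x₀⟩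

/-! ### E = X² + 1 : negative Pell `n² − 2m² = −1`, orbit (1,1) ↦ (3n+4m, 2n+3m) -/

/-- **The floor on the cell E** (instance of `OddSignQuad` at `q = X² + 1`): `Ω(n² + 1)` is odd — i.e.
`λ(n² + 1) = −1` — for infinitely many `n` (n = 1, 7, 41, 239, …). [cite: BorweinChoiGanguli2013, Thm 1] -/
theorem oddSign_X_sq_add_one :
    Set.Infinite {n : ℕ | 1 < (X ^ 2 + 1 : ℤ[X]).eval (n : ℤ) ∧
      Odd (ArithmeticFunction.cardFactors (((X ^ 2 + 1 : ℤ[X]).eval (n : ℤ)).toNat))} := by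
  obtain ⟨f, h0, hs⟩ := exists_orbit (1, 1) (fun p => (3 * p.1 + 4 * p.2, 2 * p.1 + 3 * p.2))
  have spec : ∀ j, (f j).1 ^ 2 + 1 = 2 * (f j).2 ^ 2 ∧ 1 ≤ (f j).2 := by
    intro j
    induction j with
    | zero => rw [h0]; norm_num
    | succ j ih =>
      obtain ⟨h1, h2⟩ := ih
      rw [hs j]
      exact ⟨by nlinarith [h1], by omega⟩
  have mono : StrictMono fun j => (f j).1 := by
    refine strictMono_nat_of_lt_succ fun j => ?_
    have h2 := (spec j).2
    show (f j).1 < (f (j + 1)).1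
    rw [hs j]
    show (f j).1 < 3 * (f j).1 + 4 * (f j).2
    omega
  refine oddSign_single_of_family (X ^ 2 + 1) 2
    (by rw [ArithmeticFunction.cardFactors_apply_prime Nat.prime_two]; exact odd_one)
    (fun j => (f j).1) (fun j => (f j).2) mono (fun j => (spec j).2) fun j => ?_
  have h := (spec j).1
  simp only [eval_add, eval_pow, eval_X, eval_one]
  exact_mod_cast h

/-! ### X² + 2 : `n² − 3m² = −2`, orbit (1,1) ↦ (2n+3m, n+2m) -/

/-- Instance of `OddSignQuad` at `q = X² + 2`: `Ω(n² + 2)` is odd infinitely often. [cite: Srinivasan2021, Thm 3] -/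
theorem oddSign_X_sq_add_two :
    Set.Infinite {n : ℕ | 1 < (X ^ 2 + 2 : ℤ[X]).eval (n : ℤ) ∧
      Odd (ArithmeticFunction.cardFactors (((X ^ 2 + 2 : ℤ[X]).eval (n : ℤ)).toNat))} := by
  obtain ⟨f, h0, hs⟩ := exists_orbit (1, 1) (fun p => (2 * p.1 + 3 * p.2, p.1 + 2 * p.2))
  have spec : ∀ j, (f j).1 ^ 2 + 2 = 3 * (f j).2 ^ 2 ∧ 1 ≤ (f j).2 := by
    intro j
    induction j with
    | zero => rw [h0]; norm_num
    | succ j ih =>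
      obtain ⟨h1, h2⟩ := ih
      rw [hs j]
      exact ⟨by nlinarith [h1], by omega⟩
  have mono : StrictMono fun j => (f j).1 := by
    refine strictMono_nat_of_lt_succ fun j => ?_
    have h2 := (spec j).2
    show (f j).1 < (f (j + 1)).1
    rw [hs j]
    show (f j).1 < 2 * (f j).1 + 3 * (f j).2
    omega
  refine oddSign_single_of_family (X ^ 2 + 2) 3
    (by rw [ArithmeticFunction.cardFactors_apply_prime Nat.prime_three]; exact odd_one)
    (fun j => (f j).1) (fun j => (f j).2) mono (fun j => (spec j).2) fun j => ?_
  have h := (spec j).1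
  simp only [eval_add, eval_pow, eval_X, eval_ofNat]
  exact_mod_cast h

/-! ### X² + X + 1 : `(2n+1)² − 12m² = −3`, i.e. `n² + n + 1 = 3m²`, orbit (1,1) ↦ (7n+12m+3, 4n+7m+2) -/

/-- Instance of `OddSignQuad` at `q = X² + X + 1` (b ≠ 0, outside the x²+d theorem): `Ω(n² + n + 1)` is odd
infinitely often (n = 1, 22, 313, …). [folklore] -/
theorem oddSign_X_sq_add_X_add_one :
    Set.Infinite {n : ℕ | 1 < (X ^ 2 + X + 1 : ℤ[X]).eval (n : ℤ) ∧
      Odd (ArithmeticFunction.cardFactors (((X ^ 2 + X + 1 : ℤ[X]).eval (n : ℤ)).toNat))} := by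
  obtain ⟨f, h0, hs⟩ := exists_orbit (1, 1) (fun p => (7 * p.1 + 12 * p.2 + 3, 4 * p.1 + 7 * p.2 + 2))
  have spec : ∀ j, (f j).1 ^ 2 + (f j).1 + 1 = 3 * (f j).2 ^ 2 ∧ 1 ≤ (f j).2 := by
    intro j
    induction j with
    | zero => rw [h0]; norm_num
    | succ j ih =>
      obtain ⟨h1, h2⟩ := ih
      rw [hs j]
      exact ⟨by nlinarith [h1], by omega⟩
  have mono : StrictMono fun j => (f j).1 := by
    refine strictMono_nat_of_lt_succ fun j => ?_
    show (f j).1 < (f (j + 1)).1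
    rw [hs j]
    show (f j).1 < 7 * (f j).1 + 12 * (f j).2 + 3
    omega
  refine oddSign_single_of_family (X ^ 2 + X + 1) 3
    (by rw [ArithmeticFunction.cardFactors_apply_prime Nat.prime_three]; exact odd_one)
    (fun j => (f j).1) (fun j => (f j).2) mono (fun j => (spec j).2) fun j => ?_
  have h := (spec j).1
  simp only [eval_add, eval_pow, eval_X, eval_one]
  exact_mod_cast h

end Summit.Parity.BatemanHorn.Theorems.OddSignQuadWitnesses
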